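import Mathlib.GroupTheory.Perm.Sign
import Mathlib.Algebra.BigOperators.Ring.Finset
import Mathlib.Algebra.BigOperators.Group.Finset.Sigma
import Mathlib.Data.Fintype.Perm
import Mathlib.Data.Fintype.Prod
import Mathlib.Data.Fintype.Pi
import Mathlib.Tactic.Ring
import HarnessLib

/-!
# Sign-weighted common fixed words are the injective ones (towards Kronecker coefficients as
# signed counts of binary three-dimensional arrays)

Topic `Literature/RepresentationTheory/FiniteGroups`; theorems only (no public definitions, no named
facts). Brick (P1) of the «binary 3D tables» route to the rectangular Kronecker coefficients `k_m(δ)`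
of Bürgisser–Ikenmeyer 2017 Ex. 5.6 / Rem. 5.18 (cell val-lit, NOTE-p4g5-BI17Ex56-conjunct-sizing.md):

* `sum_sign_filter_comp_eq_self` / `sum_sign_ite_comp_eq_self`: for a word `t : [D] → α`,
  `Σ_{σ ∈ 𝔖_D, t∘σ = t} sgn σ = [t injective]` — the stabiliser of `t` is the Young subgroup of its
  fibres, and a Young subgroup with a non-trivial factor carries no sign-invariant (the
  trivial-intersection property behind James–Kerber 1.3.12/1.3.13, «double cosets with the trivial
  intersection property ↔ 0-1 matrices»);
* `sum_sign_mul_card_fixed_eq_card_injective`: for three finite families of words `A, B, C`,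
  `Σ_σ sgn σ · #Fix_A(σ) · #Fix_B(σ) · #Fix_C(σ) = #{(a,b,c) ∈ A × B × C : p ↦ (a p, b p, c p) injective}`.

With the tree's `kroneckerCoeff_eq_sum_spechtCharacter_holds` (`D!·g(λ,μ,ν) = Σ_σ χ^λχ^μχ^ν`),
`spechtCharacter_transpose` (`χ^{νᵀ} = sgn·χ^ν`) and Frobenius's formula in permutation-module form
`spechtCharacter_eq_sum_sign_mul_card` (`χ^λ(σ) = Σ_τ sgn τ · #{w : w∘σ = w, cont w = λ+ρ−τρ}`,
`SymmetricGroupFrobeniusFormula.lean`), this lemma turns `g(λ,μ,ν)` (ℓ(λ), ℓ(μ), ℓ(νᵀ) ≤ N) into the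
signed count `Σ_{τ ∈ 𝔖_N³} sgn · #{0-1 arrays N×N×N with margins λ+ρ−τ₁ρ, μ+ρ−τ₂ρ, νᵀ+ρ−τ₃ρ}`
(Snapper 1971; the next brick). Numerically this already reproduces `k_7(4) = 14` (the tree's kernel
value) and BI's `k_10..16(4) = 13, 6, 5, 2, 1, 1, 1` (kit j268564).

Honest framing: finite combinatorics of words; bookkeeping towards a typed-literature fact; nothing
here bears on VP versus VNP.

## References
* [JamesKerber1981] G. James, A. Kerber, *The Representation Theory of the Symmetric Group*,
  Encyclopedia Math. Appl. 16 (1981), 1.3.12–1.3.13 (trivial-intersection double cosets and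
  `0`-`1` matrices), 2.3.15.
* E. Snapper, *Group characters and nonnegative integral matrices*, J. Algebra 19 (1971) 520–535.
* [FultonHarrisGTM129] W. Fulton, J. Harris, GTM 129, (4.41), Exercise 4.51.

Provenance: val-lit cell, prover val-lit-p4 g5 (E1, lead-bip RULINGS #26).
-/

namespace Literature.RepresentationTheory.FiniteGroups

open Finset Equiv

section SignedFixed

variable {D : ℕ} {α : Type*} [DecidableEq α]

omit [DecidableEq α] in
/-- A transposition of two positions with the same letter fixes the word. [folklore] -/
private theorem comp_swap_eq_self_of_apply_eq {t : Fin D → α} {p q : Fin D} (h : t p = t q) :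
    t ∘ ⇑(Equiv.swap p q) = t := by
  funext x
  simp only [Function.comp_apply]
  rcases eq_or_ne x p with rfl | hxp
  · rw [swap_apply_left, h]
  rcases eq_or_ne x q with rfl | hxq
  · rw [swap_apply_right, h]
  rw [swap_apply_of_ne_of_ne hxp hxq]

omit [DecidableEq α] in
/-- Only the identity fixes an injective word. [folklore] -/
private theorem eq_one_of_comp_eq_self_of_injective {t : Fin D → α} (ht : Function.Injective t)
    {σ : Perm (Fin D)} (h : t ∘ ⇑σ = t) : σ = 1 := by
  ext x
  have := congr_fun h x
  simp only [Function.comp_apply] at this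
  exact congrArg Fin.val (ht this)

/-- **The sign character summed over the stabiliser of a word is the indicator of injectivity**:
`Σ_{σ ∈ 𝔖_D, t∘σ = t} sgn σ = [t injective]`. The stabiliser is the Young subgroup of the fibres of
`t`; a fibre with two points contributes a transposition, and `σ ↦ θσ` is a sign-reversing
involution. (James–Kerber 1.3.12/1.3.13: the trivial-intersection property of Young subgroups
versus `0`-`1` matrices.) [cite: JamesKerber1981, 1.3.12–1.3.13] -/
theorem sum_sign_filter_comp_eq_self (t : Fin D → α) :
    ∑ σ ∈ (univ.filter fun σ : Perm (Fin D) => t ∘ ⇑σ = t), ((Perm.sign σ : ℤˣ) : ℤ) =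
      if Function.Injective t then 1 else 0 := by
  classical
  split_ifs with ht
  · have hset : (univ.filter fun σ : Perm (Fin D) => t ∘ ⇑σ = t) = {1} := by
      ext σ
      simp only [mem_filter, mem_univ, true_and, mem_singleton]
      exact ⟨eq_one_of_comp_eq_self_of_injective ht, fun h => by subst h; rfl⟩
    rw [hset, sum_singleton, Perm.sign_one, Units.val_one]
  · -- two positions with the same letter
    have hpq : ∃ p q : Fin D, p ≠ q ∧ t p = t q := by
      by_contra hcon
      apply ht
      intro p q hpq'
      by_contra hne
      exact hcon ⟨p, q, hne, hpq'⟩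
    obtain ⟨p, q, hpq, htpq⟩ := hpq
    set θ : Perm (Fin D) := Equiv.swap p q with hθ
    have hθt : t ∘ ⇑θ = t := comp_swap_eq_self_of_apply_eq htpq
    refine Finset.sum_involution (fun σ _ => θ * σ) ?_ ?_ ?_ ?_
    · intro σ hσ
      rw [Perm.sign_mul, Units.val_mul, Perm.sign_swap hpq, Units.val_neg, Units.val_one]
      ring
    · intro σ _ _ h
      have : θ = 1 := by
        have h' := congrArg (· * σ⁻¹) h
        simpa using h'
      exact (Equiv.swap_eq_one_iff.not.mpr hpq) this |>.elim
    · intro σ hσ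
      rw [mem_filter] at hσ ⊢
      refine ⟨mem_univ _, ?_⟩
      rw [Perm.coe_mul, ← Function.comp_assoc, hθt, hσ.2]
    · intro σ _
      rw [← mul_assoc, hθ, Equiv.swap_mul_self, one_mul]

/-- The same statement with an `if` inside the sum over all of `𝔖_D`. [cite: JamesKerber1981, 1.3.12–1.3.13] -/
theorem sum_sign_ite_comp_eq_self (t : Fin D → α) :
    ∑ σ : Perm (Fin D), (if t ∘ ⇑σ = t then ((Perm.sign σ : ℤˣ) : ℤ) else 0) =
      if Function.Injective t then 1 else 0 := by
  rw [← sum_sign_filter_comp_eq_self t, Finset.sum_filter]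

end SignedFixed

/-! ### Three families of words: sign-weighted common fixed points count injective triples -/

section Triples

variable {D : ℕ} {α β γ : Type*} [DecidableEq α] [DecidableEq β] [DecidableEq γ]

omit [DecidableEq α] [DecidableEq β] [DecidableEq γ] in
/-- A permutation fixes the triple word iff it fixes the three words. [folklore] -/
private theorem zipWords_comp_eq_iff (x : (Fin D → α) × (Fin D → β) × (Fin D → γ)) (σ : Perm (Fin D)) :
    (fun p => ((x.1 p, x.2.1 p), x.2.2 p)) ∘ ⇑σ = (fun p => ((x.1 p, x.2.1 p), x.2.2 p)) ↔
      x.1 ∘ ⇑σ = x.1 ∧ x.2.1 ∘ ⇑σ = x.2.1 ∧ x.2.2 ∘ ⇑σ = x.2.2 := by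
  constructor
  · intro h
    refine ⟨funext fun p => ?_, funext fun p => ?_, funext fun p => ?_⟩ <;>
    · have := congr_fun h p
      simp only [Function.comp_apply, Prod.mk.injEq] at this
      simp only [Function.comp_apply]
      tauto
  · rintro ⟨h1, h2, h3⟩
    funext p
    simp only [Function.comp_apply]
    rw [show x.1 (σ p) = x.1 p from congr_fun h1 p, show x.2.1 (σ p) = x.2.1 p from congr_fun h2 p,
      show x.2.2 (σ p) = x.2.2 p from congr_fun h3 p]

/-- **Sign-weighted common fixed points of three families of words count the injective triples**:
for finite families `A, B, C` of words of length `D`,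
`Σ_{σ ∈ 𝔖_D} sgn σ · #{a ∈ A : a∘σ = a} · #{b ∈ B : b∘σ = b} · #{c ∈ C : c∘σ = c}
  = #{(a,b,c) ∈ A × B × C : p ↦ (a p, b p, c p) injective}`
— with Frobenius's formula `χ^λ = Σ_τ sgn τ · ψ_{λ+ρ−τρ}` and `χ^{νᵀ} = sgn·χ^ν`, this turns
`D!·g(λ,μ,ν) = Σ_σ χ^λ χ^μ χ^ν` into a signed count of `0`-`1` three-dimensional arrays
(the three-factor form of James–Kerber 1.3.13; Snapper 1971).
[cite: JamesKerber1981, 1.3.12–1.3.13] -/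
theorem sum_sign_mul_card_fixed_eq_card_injective (A : Finset (Fin D → α)) (B : Finset (Fin D → β))
    (C : Finset (Fin D → γ)) :
    ∑ σ : Perm (Fin D), ((Perm.sign σ : ℤˣ) : ℤ) *
        ((A.filter fun a => a ∘ ⇑σ = a).card * (B.filter fun b => b ∘ ⇑σ = b).card *
          (C.filter fun c => c ∘ ⇑σ = c).card : ℕ) =
      (((A ×ˢ B ×ˢ C).filter fun x => Function.Injective (fun p => ((x.1 p, x.2.1 p), x.2.2 p))).card : ℤ) := by
  classical
  -- the product of the three counts is the number of fixed triples
  have hprod : ∀ σ : Perm (Fin D),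
      ((A.filter fun a => a ∘ ⇑σ = a).card * (B.filter fun b => b ∘ ⇑σ = b).card *
          (C.filter fun c => c ∘ ⇑σ = c).card : ℕ) =
        ((A ×ˢ B ×ˢ C).filter fun x =>
          (fun p => ((x.1 p, x.2.1 p), x.2.2 p)) ∘ ⇑σ = (fun p => ((x.1 p, x.2.1 p), x.2.2 p))).card := by
    intro σ
    rw [mul_assoc, ← Finset.card_product, ← Finset.card_product, ← Finset.filter_product,
      ← Finset.filter_product]
    refine congrArg Finset.card (Finset.filter_congr fun x _ => ?_)
    rw [zipWords_comp_eq_iff]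
  simp_rw [hprod]
  -- exchange the sums
  rw [show (((A ×ˢ B ×ˢ C).filter fun x =>
        Function.Injective (fun p => ((x.1 p, x.2.1 p), x.2.2 p))).card : ℤ) =
      ∑ x ∈ A ×ˢ B ×ˢ C, (if Function.Injective (fun p => ((x.1 p, x.2.1 p), x.2.2 p)) then (1 : ℤ) else 0) by
    rw [Finset.card_filter, Nat.cast_sum]
    refine Finset.sum_congr rfl fun x _ => ?_
    split_ifs <;> simp]
  simp_rw [← sum_sign_ite_comp_eq_self, Finset.card_filter, Nat.cast_sum, Finset.mul_sum]
  rw [Finset.sum_comm]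
  refine Finset.sum_congr rfl fun x _ => Finset.sum_congr rfl fun σ _ => ?_
  split_ifs <;> simp

end Triples

end Literature.RepresentationTheory.FiniteGroups
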